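import Literature.NumberTheory.EllipticCurves.Castella2024.LambdaAdicHeegnerClassExistence
import HarnessLib

/-!
# Route UniversalToricDescent — the norm relation of a coherent Heegner family COMPOSED along the layers
# (brick 4a of the port stub `stub_residualLinkMult` of line `beta-road` v5 on crux `TwinAlgMuZeroAtThree`, stmt-BirchSwinnertonDyer-24737)

Lead prover bsd-wall-utd-p1 g23 (`--supports stmt-BirchSwinnertonDyer-24737`). For a Heegner family `F` along a `ℤ_p`-extension `κ`
of a number field `K` with topological generator `γ`, NORM-COHERENT with sign `α` (`HeegnerFamily.IsNormCompatible F γ α`: the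
two-term relation `∑_{i<p} γ^{pⁿ i} • z_{n+1} = α • z_n`, Bertolini–Darmon 1996 §2.5 (7)), the relation composes over `m` layers:

* §1 `sum_range_mul_eq_sum_sum` — `∑_{l<a·b} g l = ∑_{i<b} ∑_{x<a} g (a·i + x)` (splitting a range of length `a·b` into `b` blocks).
* §2 **`IsNormCompatible.sum_transversal_smul_z`** — `∑_{l<p^m} γ^{p^k l} • z_{k+m} = α^m • z_k`: the trace from the layer
  `K_{k+m}` to `K_k`, summed over the transversal `{γ^{p^k l}}_{l<p^m}` of `Gal(K̄/K_{k+m})` in `Gal(K̄/K_k)`, of the norm point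
  `z_{k+m}` is `α^m z_k` (induction on `m`, regrouping `l = p^m i + x`).

With `α² = 1` (`α = a_p = ±1` at `p ∥ N`) the right side is `± z_k`; read through the Kummer map and restricted to a prime above
`p`, this is the input «norm of the layer-`n` local class = ± the layer-`k` local class ≠ 0» of `…ResidualNormSpan` (p737965).
THEOREMS ONLY (no definition, no named fact, no `sorry`). BSD is not advanced by this file.
References: [BertoliniDarmon1996] §2.4–2.5, eq. (7) (p. 435); [PerrinRiou1987BSMF] §3.3 (norm-compatible Heegner points).
-/

set_option linter.dupNamespace false
set_option autoImplicit false

noncomputable section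

open Finset

namespace Summit.BirchSwinnertonDyer.BirchSwinnertonDyer.Theorems.UniversalToricDescentHeegnerNormTransversal

open Literature.NumberTheory.EllipticCurves WeierstrassCurve

/-! ## §1 Splitting a range of length `a·b` -/

/-- `∑_{l<a·b} g l = ∑_{i<b} ∑_{x<a} g (a·i + x)`. [folklore] -/
theorem sum_range_mul_eq_sum_sum {M : Type*} [AddCommMonoid M] (g : ℕ → M) (a b : ℕ) :
    ∑ l ∈ range (a * b), g l = ∑ i ∈ range b, ∑ x ∈ range a, g (a * i + x) := by
  induction b with
  | zero => simp
  | succ b ih => rw [Nat.mul_succ, sum_range_add, ih, sum_range_succ]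

/-! ## §2 The composed norm relation -/

variable {K : Type} [Field K] [NumberField K] {N : ℕ} [NeZero N] {W : WeierstrassCurve ℚ}
  {p : ℕ} [hp : Fact p.Prime] {κ : ZpExtension K p} {jbar : AlgebraicClosure K →+* ℂ}

/-- **The norm relation composed over `m` layers**: for a coherent family (`∑_{i<p} γ^{pⁿ i} • z_{n+1} = α • z_n` for all `n`),
`∑_{l<p^m} γ^{p^k l} • z_{k+m} = α^m • z_k` — the trace `Tr_{K_{k+m}/K_k}` over the transversal `{γ^{p^k l}}_{l<p^m}`.
[cite: BertoliniDarmon1996, §2.5 eq. (7) (p. 435)] -/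
theorem sum_transversal_smul_z (F : HeegnerFamily N W K κ jbar) {γ : Field.absoluteGaloisGroup K} {α : ℤ}
    (h : F.IsNormCompatible γ α) (k m : ℕ) :
    ∑ l ∈ range (p ^ m), (γ ^ (p ^ k * l)) • F.z (k + m) = α ^ m • F.z k := by
  induction m with
  | zero => simp
  | succ m ih =>
    rw [pow_succ, sum_range_mul_eq_sum_sum, sum_comm]
    have hinner : ∀ x ∈ range (p ^ m),
        ∑ i ∈ range p, (γ ^ (p ^ k * (p ^ m * i + x))) • F.z (k + (m + 1)) =
          (γ ^ (p ^ k * x)) • (α • F.z (k + m)) := by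
      intro x _
      have hexp : ∀ i : ℕ, p ^ k * (p ^ m * i + x) = p ^ k * x + p ^ (k + m) * i := fun i ↦ by ring
      simp_rw [hexp, pow_add γ, mul_smul, ← smul_sum]
      rw [← add_assoc, h.sum_smul_z_eq (k + m)]
    rw [sum_congr rfl hinner]
    simp_rw [smul_zsmul_geomPoints, ← smul_sum, ih, ← mul_zsmul, pow_succ']

end Summit.BirchSwinnertonDyer.BirchSwinnertonDyer.Theorems.UniversalToricDescentHeegnerNormTransversal

end
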